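import Mathlib
import HarnessLib
import Summits.PneNP.PneNP.Theses.UniformStream
import Summits.PneNP.PneNP.Theorems.UniformStreamUniformMagnification
import Summits.PneNP.PneNP.Theorems.UniformStreamUniformStreamLBStubSimulation
import Summits.PneNP.PneNP.Theorems.UniformStreamUniformStreamLBStubTransfer
import Summits.PneNP.PneNP.Theorems.UniformStreamUniformStreamLBLowLevels

/-!
# The open stub of line `birth` of the crux `UniformStreamLB` is SUMMIT-HARD (stub ⟹ crux ⟹ `PneNP`)

Route `UniformStream`, crux `Summit.PneNP.PneNP.Theses.UniformStream.UniformStreamLB` (stmt-PneNP-16045;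
McKay–Murray–Williams 2019, Thm. 1.3 — its hypothesis, uniform decision form), line `birth` / `registered`
(`Cruxes/UniformStreamLB/Lines/birth.lean`). The line's only open registered stub is the transferred lower bound

  C⁺ = `stub_MCSP_not_mem_DTISP` :
  `∃ s` time-constructible, `∀ c`, `MCSPSize s ∉ DTISP (N ↦ N·s(⌊log₂N⌋)^c) (N ↦ s(⌊log₂N⌋)^c)`.

This file records, as theorems whose hypotheses are the REGISTERED STUB SIGNATURE VERBATIM (resp. the crux, resp.
the sharper `s = id` slice of lead c2), that each of them already implies the summit statement `PneNP` inside the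
tree — so no decomposition of this crux can have a stub below the summit:

* `pneNP_of_uniformStreamLB : UniformStreamLB → PneNP` — the route's deciding theorem `UniformStream.closes`
  fed with the LANDED magnification crux `uniformStream_uniformMagnification_proof` (stmt-PneNP-16047,
  McKay–Murray–Williams 2019, Thm. 1.3, typed and proved in the tree's model);
* `uniformStreamLB_of_stub : C⁺ → UniformStreamLB` — the line's composition (landed stubs `stub_transfer`
  p153228 ∘ `stub_simulation` p152730), restated with the stub signature as an explicit hypothesis;
* `stub_pneNP_of_MCSP_not_mem_DTISP : C⁺ → PneNP` — the stub ⟹ summit certificate (shape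
  `<registered stub signature> → PneNP`; registered as a sub-goal of stmt-PneNP-16045 so that it lands by name);
* `pneNP_of_MCSP_id_not_mem_DTISP_high : (∀ c ≥ 3, MCSPSize id ∉ DTISP(N·⌊log₂N⌋^c, ⌊log₂N⌋^c)) → PneNP` — even
  the `s = id`, level-`≥ 3` slice (`uniformStreamLB_of_id_high`, p160584) is summit-hard.

Together with `uniformStreamLB_of_hardPRG : HardPRGExist → UniformStreamLB` (p156286) the crux and its stub are
pinned between the SPRNG conjecture and `P ≠ NP`; neither endpoint is decidable in the tree today, which is the
lead's (c3) reason for handing the stub back (`promote-stub`) rather than re-lining it.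

References: D. M. McKay, C. D. Murray, R. R. Williams, *Weak lower bounds on resource-bounded compression imply
strong separations of complexity classes*, STOC 2019, Thm. 1.3 [MckayMurrayWilliams2019]; S. Arora, B. Barak,
*Computational Complexity* (2009), Def. 5.10 (TISP) [AroraBarak2009].
-/

set_option linter.dupNamespace false -- `Summit.PneNP.PneNP.…`: summit = sub-problem (D-0017)

noncomputable section

namespace Summit.PneNP.PneNP.Theorems.UniformStreamLB.SummitHard

open Literature.Computability.Complexity Literature.Computability.MetaComplexity
open Summit.PneNP.PneNP.Theses.UniformStream

/-- **Crux ⟹ summit.** `UniformStreamLB → PneNP`: the route's deciding theorem `UniformStream.closes` applied to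
the landed magnification crux `uniformStream_uniformMagnification_proof` (stmt-PneNP-16047). So any proof of the
crux is a proof of `P ≠ NP` in the tree. [cite: MckayMurrayWilliams2019, Thm. 1.3] -/
theorem pneNP_of_uniformStreamLB : UniformStreamLB → PneNP :=
  fun hlb => closes hlb Summit.PneNP.PneNP.Theorems.uniformStream_uniformMagnification_proof

/-- **Stub ⟹ crux.** The registered open stub C⁺ = `stub_MCSP_not_mem_DTISP` of line `birth` (its signature
verbatim as the hypothesis) gives the crux, by the landed stubs `stub_transfer` (p153228) and `stub_simulation`
(p152730) — the line's composition `UniformStreamLB_of` with the sorry replaced by a hypothesis. [folklore] -/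
theorem uniformStreamLB_of_stub
    (hC : ∃ s : ℕ → ℕ, Literature.Computability.Complexity.IsTimeConstructible s ∧ ∀ c : ℕ,
      Literature.Computability.MetaComplexity.MCSPSize s ∉
        Literature.Computability.Complexity.DTISP (fun N => N * s (Nat.log 2 N) ^ c)
          (fun N => s (Nat.log 2 N) ^ c)) :
    UniformStreamLB :=
  Birth.stub_transfer Birth.stub_simulation hC

/-- **Stub ⟹ summit (the summit-hardness certificate of `stub_MCSP_not_mem_DTISP`; registered sub-goal
`stub_pneNP_of_MCSP_not_mem_DTISP` of stmt-PneNP-16045).** The registered open stub of line `birth` of the crux,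
with its signature verbatim as the hypothesis, implies `PneNP`: C⁺ ⟹ `UniformStreamLB` (`uniformStreamLB_of_stub`)
⟹ `PneNP` (`pneNP_of_uniformStreamLB`). Hence the stub is at least as hard as the summit and cannot be re-lined
below it. [cite: MckayMurrayWilliams2019, Thm. 1.3] -/
theorem stub_pneNP_of_MCSP_not_mem_DTISP (hC : ∃ s : ℕ → ℕ, Literature.Computability.Complexity.IsTimeConstructible s ∧ ∀ c : ℕ, Literature.Computability.MetaComplexity.MCSPSize s ∉ Literature.Computability.Complexity.DTISP (fun N => N * s (Nat.log 2 N) ^ c) (fun N => s (Nat.log 2 N) ^ c)) : PneNP :=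
  pneNP_of_uniformStreamLB (uniformStreamLB_of_stub hC)

/-- **Even the `s = id`, level-`≥ 3` slice is summit-hard.** If `MCSP[n ↦ n]` (truth tables of `n`-variable
functions with `B₂`-circuits of at most `n` gates, `N = 2ⁿ`) is outside `DTISP(N·⌊log₂N⌋^c, ⌊log₂N⌋^c)` for every
`c ≥ 3` — "`MCSP[log N]` is not decidable in quasi-linear time and polylogarithmic space simultaneously" — then
`P ≠ NP`: by lead c2's `uniformStreamLB_of_id_high` (p160584; levels `c ≤ 1` unconditional, the rest by the
per-level transfer) and `pneNP_of_uniformStreamLB`. [cite: MckayMurrayWilliams2019, Thm. 1.1 and Thm. 1.3] -/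
theorem pneNP_of_MCSP_id_not_mem_DTISP_high
    (hhigh : ∀ c : ℕ, 3 ≤ c →
      MCSPSize (fun n => n) ∉ DTISP (fun N => N * Nat.log 2 N ^ c) (fun N => Nat.log 2 N ^ c)) :
    PneNP :=
  pneNP_of_uniformStreamLB (Birth.uniformStreamLB_of_id_high hhigh)

end Summit.PneNP.PneNP.Theorems.UniformStreamLB.SummitHard

end
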